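import Summits.AtomisticToContinuum.BoseEinsteinCondensation.Theorems.BECThomsonPrincipleGDTransferSeededSpectralDefs
import Summits.AtomisticToContinuum.BoseEinsteinCondensation.Theorems.BECThomsonPrincipleGDTransferSeededSharpCutSplitting
import Summits.AtomisticToContinuum.BoseEinsteinCondensation.Theorems.BECThomsonPrincipleGDTransferSeededPointwiseCatExclusion
import Summits.AtomisticToContinuum.BoseEinsteinCondensation.Theorems.BECThomsonPrincipleGDTransferSeededPlainAdjoint

/-!
# Route `BECThomsonPrinciple`, crux `GDTransfer` (stmt-AtomisticToContinuum-9482), line `seeded-continuity`: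
# spectral seed programme — the ASSEMBLY `seedFor_of_kyFanGapFloor`

Supports (does not close) stmt-AtomisticToContinuum-9482: proves the registered sub-goal
`seedFor_of_kyFanGapFloor : SmoothBlockAlgebra → SmoothSplitting → PinchingBound → CatKyFan →
∀ v, IsRepulsiveFiniteRange v → IsFiniteContinuous v → KyFanGapFloorFor v → NoBalancedCatFor v`
of the lead's seventh Defs file `…SeededSpectralDefs` (wave 2 of the spectral seed programme).

**Proof.**  Fix band parameters `θ, β` (`w = 1 − β − θ > 0`), put `τ = 1/4` (so `8/τ² = 128`),
`‖v‖₁ = lift1 v`, and take the gap constant `K = 256 + 81920 π² ‖v‖₁ / w²`; the Ky Fan gap floor at `K`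
gives `ρ₀, N₀`.  At `(N, L) = (m + 1, L)` on the dilute path with `E₀ ≠ ⊤` choose the slack
`δ = w² / (2 (w² + 128π²) L³)`.  If a `δ`-near-minimiser `Ψ` carried mass `≥ τ` on both sides, its two
smooth blocks `f = χ_lo(n̂₀/N)Ψ`, `g = χ_hi(n̂₀/N)Ψ` (directions, `SmoothBlockAlgebra`; finite energy forms
since the interaction of a finite continuous finite-range profile is bounded on configuration space) satisfy
`𝓔(f) + 𝓔(g) ≤ E(Ψ) + (8π²/(w²N²))·D(Ψ) ≤ E₀ + Δ`, `Δ = δ + (8π²/(w²N²))·D(Ψ)` (`SmoothSplitting`),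
where the pinched interaction is `D(Ψ) ≤ 16 ∫V|Ψ|² + 64‖v‖₁N²/L³` (`PinchingBound`),
`∫V|Ψ|² ≤ E(Ψ) ≤ E₀ + δ` and `E₀ ≤ N²‖v‖₁/L³` (constant trial state,
`PlainCost.periodicGroundStateEnergy_le_const`); so `128·Δ ≤ 64/L³ + 81920π²‖v‖₁/(w²L³) < K/L³`
(`SpectralSeed.cost_lt_gap`).  But `CatKyFan` gives `kyFanTwo ≤ 2E₀ + 128Δ` while the floor gives
`2E₀ + K/L³ ≤ kyFanTwo`, and `2E₀ < ∞` — contradiction.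

References: ReedSimonIV1978 Thm XIII.1–2 (min-max, Ky Fan); CyconFroeseKirschSimon1987 §3.1 (IMS
localisation); LSSY2005 §1.2.
-/

noncomputable section

open MeasureTheory Filter
open scoped ENNReal NNReal ComplexConjugate

namespace Summit.AtomisticToContinuum.BoseEinsteinCondensation.Cruxes.GDTransfer.Seeded

namespace SpectralSeed

/-- **The constants of the assembly** (pure real arithmetic): with `w > 0`, `L > 0`, `N ≥ 1` (and any real
`I`; in the application `I = ‖v‖₁ ≥ 0`), the slack `δ = w²/(2(w² + 128π²)L³)`, the splitting coefficient
`8π²/(w²N²)` and the pinching bound `16(N²I/L³ + δ) + 64IN²/L³`, one has `128·(δ + cost) < K/L³` for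
`K = 256 + 81920π²I/w²` (the `I`-terms cancel exactly; the `δ`-terms give `64/L³ < 256/L³`). [folklore] -/
theorem cost_lt_gap {w L N : ℝ} (I : ℝ) (hw : 0 < w) (hL : 0 < L) (hN : 1 ≤ N) :
    128 * (w ^ 2 / (2 * (w ^ 2 + 128 * Real.pi ^ 2) * L ^ 3) +
        8 * Real.pi ^ 2 / (w ^ 2 * N ^ 2) *
          (16 * (N ^ 2 / L ^ 3 * I + w ^ 2 / (2 * (w ^ 2 + 128 * Real.pi ^ 2) * L ^ 3)) +
            64 * I * N ^ 2 / L ^ 3)) <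
      (256 + 81920 * Real.pi ^ 2 * I / w ^ 2) / L ^ 3 := by
  have hL3 : 0 < L ^ 3 := by positivity
  have hN0 : 0 < N := by linarith
  have hP0 : 0 < Real.pi ^ 2 := by positivity
  set P := Real.pi ^ 2 with hP
  set δr := w ^ 2 / (2 * (w ^ 2 + 128 * P) * L ^ 3) with hδr
  set c₁ := 8 * P / (w ^ 2 * N ^ 2) with hc₁
  have hδr0 : 0 ≤ δr := by positivity
  have e1 : c₁ * (16 * (N ^ 2 / L ^ 3 * I)) = 128 * P * I / (w ^ 2 * L ^ 3) := by
    rw [hc₁]; field_simp; ring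
  have e2 : c₁ * (64 * I * N ^ 2 / L ^ 3) = 512 * P * I / (w ^ 2 * L ^ 3) := by
    rw [hc₁]; field_simp; ring
  have i3 : c₁ * (16 * δr) ≤ 8 * P / w ^ 2 * (16 * δr) := by
    refine mul_le_mul_of_nonneg_right ?_ (by positivity)
    rw [hc₁]
    refine div_le_div_of_nonneg_left (by positivity) (by positivity) ?_
    have hN2 : (1 : ℝ) ≤ N ^ 2 := by nlinarith
    nlinarith [mul_le_mul_of_nonneg_left hN2 (sq_nonneg w)]
  have e4 : 128 * (δr + 8 * P / w ^ 2 * (16 * δr)) = 64 / L ^ 3 := by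
    rw [hδr]; field_simp; ring
  have e5 : (256 + 81920 * P * I / w ^ 2) / L ^ 3 = 256 / L ^ 3 + 81920 * P * I / (w ^ 2 * L ^ 3) := by
    rw [add_div, div_div]
  calc 128 * (δr + c₁ * (16 * (N ^ 2 / L ^ 3 * I + δr) + 64 * I * N ^ 2 / L ^ 3))
      = 128 * (δr + c₁ * (16 * δr)) +
          128 * (c₁ * (16 * (N ^ 2 / L ^ 3 * I)) + c₁ * (64 * I * N ^ 2 / L ^ 3)) := by ring
    _ ≤ 128 * (δr + 8 * P / w ^ 2 * (16 * δr)) +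
          128 * (128 * P * I / (w ^ 2 * L ^ 3) + 512 * P * I / (w ^ 2 * L ^ 3)) := by
        rw [e1, e2]; gcongr
    _ = 64 / L ^ 3 + 81920 * P * I / (w ^ 2 * L ^ 3) := by rw [e4]; ring
    _ < 256 / L ^ 3 + 81920 * P * I / (w ^ 2 * L ^ 3) := by gcongr; norm_num
    _ = (256 + 81920 * P * I / w ^ 2) / L ^ 3 := e5.symm

end SpectralSeed

open Literature.MathematicalPhysics.QuantumManyBody.BoseGas
open Summit.AtomisticToContinuum.BoseEinsteinCondensation.Cruxes.GDTransfer.DysonDressedWitness (eform)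
open Summit.AtomisticToContinuum.BoseEinsteinCondensation.Theorems (exists_bound_of_continuous_finiteRange
  exists_bound_periodizedPotential_of_space)

/-- **Registered sub-goal `seedFor_of_kyFanGapFloor` of the spectral seed programme** (line
`seeded-continuity`, crux `GDTransfer`, stmt-AtomisticToContinuum-9482): at a finite continuous admissible
potential, a Ky Fan gap floor `kyFanTwo − 2E₀ ≥ K/L³` along the dilute path excludes balanced cats among
near-minimisers with `τ = 1/4` chosen BEFORE `N` — the smooth IMS split (`SmoothSplitting`, cost
`8π²/(w²N²)·D`), the pinching bound (`D ≤ 16∫V|Ψ|² + 64‖v‖₁N²/L³`), the constant-state bound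
`E₀ ≤ N²‖v‖₁/L³` and the Gram–Schmidt Ky Fan bound (`CatKyFan`) assembled with explicit constants
(`SpectralSeed.cost_lt_gap`). [cite: ReedSimonIV1978, Thm XIII.1] -/
theorem seedFor_of_kyFanGapFloor : SmoothBlockAlgebra → SmoothSplitting → PinchingBound → CatKyFan →
    ∀ v : ℝ → ℝ≥0∞, IsRepulsiveFiniteRange v → IsFiniteContinuous v → KyFanGapFloorFor v →
      NoBalancedCatFor v := by
  intro hB hS hP hK v hv hfc hGap θ β hθ hβ hθβ
  have hw : 0 < 1 - β - θ := by linarith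
  have hmeas : Measurable v := hv.1
  obtain ⟨R₀, hR₀⟩ := hv.2
  -- `‖v‖₁ = lift1 v` is a finite nonnegative real
  have hint : (∫⁻ x : Space, v ‖x‖) ≠ ⊤ := lintegral_ne_top_of_isFiniteContinuous hv hfc
  have hI0 : 0 ≤ lift1 v := ENNReal.toReal_nonneg
  have hIeq : (∫⁻ x : Space, v ‖x‖) = ENNReal.ofReal (lift1 v) := (ENNReal.ofReal_toReal hint).symm
  -- the gap constant and the dilute path from the floor
  set K : ℝ := 256 + 81920 * Real.pi ^ 2 * lift1 v / (1 - β - θ) ^ 2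
  have hK0 : 0 < K := by positivity
  obtain ⟨ρ₀, hρ₀, N₀, hN₀⟩ := hGap K hK0
  refine ⟨1 / 4, by norm_num, by norm_num, ρ₀, hρ₀, N₀, fun m hm L hL hρ hE₀ => ?_⟩
  -- the slack
  set δr : ℝ := (1 - β - θ) ^ 2 / (2 * ((1 - β - θ) ^ 2 + 128 * Real.pi ^ 2) * L ^ 3)
  have hδr0 : 0 < δr := by positivity
  refine ⟨ENNReal.ofReal δr, ENNReal.ofReal_pos.2 hδr0, fun Ψ hΨ hcat => ?_⟩
  obtain ⟨hlo, hhi⟩ := hcat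
  set E₀ := periodicGroundStateEnergy v (m + 1) L
  -- the interaction is bounded on configuration space, so the block forms are finite
  obtain ⟨M, hM⟩ := exists_bound_of_continuous_finiteRange hfc.1 hfc.2 hR₀
  obtain ⟨Cper, hCper⟩ := exists_bound_periodizedPotential_of_space hL hM hR₀
  have hW : ∀ X : Config (m + 1), periodicInteraction v L X ≤
      ((((m + 1 : ℕ) : ℝ≥0) * (((m + 1 : ℕ) : ℝ≥0) * Cper) : ℝ≥0) : ℝ≥0∞) := fun X =>
    periodicInteraction_le_of_periodized_le hCper X
  obtain ⟨hfdir, hgdir, -⟩ := hB m L hL θ β hθ hβ hθβ Ψ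
  have hftop : eform v L (smoothBlock m L (cutLo θ β) Ψ.ψ) ≠ ⊤ :=
    SharpCut.eform_ne_top_of_bounded v hW hfdir.contDiff
  have hgtop : eform v L (smoothBlock m L (cutHi θ β) Ψ.ψ) ≠ ⊤ :=
    SharpCut.eform_ne_top_of_bounded v hW hgdir.contDiff
  -- the smooth splitting: `𝓔(f) + 𝓔(g) ≤ E(Ψ) + A·D ≤ E₀ + Δ`
  set A := ENNReal.ofReal (8 * Real.pi ^ 2 / ((1 - β - θ) ^ 2 * (((m : ℝ) + 1) ^ 2))) with hA_def
  set D := sectorDiagV v m L Ψ.ψ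
  have hsplit : eform v L (smoothBlock m L (cutLo θ β) Ψ.ψ) +
      eform v L (smoothBlock m L (cutHi θ β) Ψ.ψ) ≤ periodicEnergy v Ψ + A * D :=
    hS v hv hfc m L hL θ β hθ hβ hθβ Ψ
  set Δ := ENNReal.ofReal δr + A * D with hΔ_def
  have hsum : eform v L (smoothBlock m L (cutLo θ β) Ψ.ψ) +
      eform v L (smoothBlock m L (cutHi θ β) Ψ.ψ) ≤ E₀ + Δ := by
    refine hsplit.trans ?_
    rw [hΔ_def, ← add_assoc]
    exact add_le_add hΨ le_rfl
  -- the cat forces a small Ky Fan gap …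
  have hup : kyFanTwo v (m + 1) L ≤ 2 * E₀ + ENNReal.ofReal (8 / (1 / 4) ^ 2) * Δ :=
    hK hB v hmeas m L hL hE₀ θ β hθ hβ hθβ (1 / 4) (by norm_num) (by norm_num) Ψ Δ hftop hgtop hsum
      hlo hhi
  -- … while the floor is `K/L³`
  have hdown : 2 * E₀ + ENNReal.ofReal (K / L ^ 3) ≤ kyFanTwo v (m + 1) L := hN₀ m hm L hL hρ
  -- the cost in real terms
  have hWΨ : (∫⁻ X in cellN (m + 1) L, periodicInteraction v L X * (‖Ψ.ψ X‖₊ : ℝ≥0∞) ^ 2) ≤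
      E₀ + ENNReal.ofReal δr :=
    (PlainCost.lintegral_W_le_eform v L Ψ.ψ).trans hΨ
  have hE₀le : E₀ ≤ ENNReal.ofReal (((m : ℝ) + 1) ^ 2 / L ^ 3 * lift1 v) := by
    calc E₀ ≤ ENNReal.ofReal (((m : ℝ) + 1) ^ 2 / L ^ 3) * ∫⁻ x : Space, v ‖x‖ :=
          PlainCost.periodicGroundStateEnergy_le_const hmeas m hL
      _ = ENNReal.ofReal (((m : ℝ) + 1) ^ 2 / L ^ 3 * lift1 v) := by
          rw [hIeq, ← ENNReal.ofReal_mul (by positivity)]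
  have hDle : D ≤ ENNReal.ofReal (16 * (((m : ℝ) + 1) ^ 2 / L ^ 3 * lift1 v + δr) +
      64 * lift1 v * ((m : ℝ) + 1) ^ 2 / L ^ 3) := by
    calc D ≤ 16 * (∫⁻ X in cellN (m + 1) L, periodicInteraction v L X * (‖Ψ.ψ X‖₊ : ℝ≥0∞) ^ 2) +
          ENNReal.ofReal (64 * lift1 v * ((m : ℝ) + 1) ^ 2 / L ^ 3) := hP v hv hfc m L hL Ψ
      _ ≤ 16 * (ENNReal.ofReal (((m : ℝ) + 1) ^ 2 / L ^ 3 * lift1 v) + ENNReal.ofReal δr) +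
          ENNReal.ofReal (64 * lift1 v * ((m : ℝ) + 1) ^ 2 / L ^ 3) := by
          gcongr
          exact hWΨ.trans (add_le_add hE₀le le_rfl)
      _ = ENNReal.ofReal (16 * (((m : ℝ) + 1) ^ 2 / L ^ 3 * lift1 v + δr) +
          64 * lift1 v * ((m : ℝ) + 1) ^ 2 / L ^ 3) := by
          rw [← ENNReal.ofReal_add (by positivity) hδr0.le, ← ENNReal.ofReal_ofNat 16,
            ← ENNReal.ofReal_mul (by norm_num), ← ENNReal.ofReal_add (by positivity) (by positivity)]
  have hΔle : ENNReal.ofReal (8 / (1 / 4) ^ 2) * Δ ≤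
      ENNReal.ofReal (128 * (δr + 8 * Real.pi ^ 2 / ((1 - β - θ) ^ 2 * (((m : ℝ) + 1) ^ 2)) *
        (16 * (((m : ℝ) + 1) ^ 2 / L ^ 3 * lift1 v + δr) +
          64 * lift1 v * ((m : ℝ) + 1) ^ 2 / L ^ 3))) := by
    have h128 : (8 / (1 / 4) ^ 2 : ℝ) = 128 := by norm_num
    calc ENNReal.ofReal (8 / (1 / 4) ^ 2) * Δ
        ≤ ENNReal.ofReal (8 / (1 / 4) ^ 2) * (ENNReal.ofReal δr + A *
            ENNReal.ofReal (16 * (((m : ℝ) + 1) ^ 2 / L ^ 3 * lift1 v + δr) +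
              64 * lift1 v * ((m : ℝ) + 1) ^ 2 / L ^ 3)) := by
          rw [hΔ_def]; gcongr
      _ = _ := by
          rw [hA_def, ← ENNReal.ofReal_mul (by positivity), ← ENNReal.ofReal_add hδr0.le (by positivity),
            ← ENNReal.ofReal_mul (by positivity), h128]
  -- the arithmetic: `128·(δ + cost) < K/L³`
  have hN1 : (1 : ℝ) ≤ (m : ℝ) + 1 := le_add_of_nonneg_left m.cast_nonneg
  have hreal := SpectralSeed.cost_lt_gap (lift1 v) hw hL hN1
  have hlt : 2 * E₀ + ENNReal.ofReal (8 / (1 / 4) ^ 2) * Δ < 2 * E₀ + ENNReal.ofReal (K / L ^ 3) :=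
    ENNReal.add_lt_add_left (ENNReal.mul_ne_top ENNReal.ofNat_ne_top hE₀)
      (hΔle.trans_lt ((ENNReal.ofReal_lt_ofReal_iff (by positivity)).2 hreal))
  exact lt_irrefl _ ((hdown.trans hup).trans_lt hlt)

end Summit.AtomisticToContinuum.BoseEinsteinCondensation.Cruxes.GDTransfer.Seeded

end
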